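import Literature.MathematicalPhysics.QuantumLattice.InfiniteVolumeLSMBondProofs
import HarnessLib

/-!
# The twisted chain Hamiltonian and the block-magnetisation double commutator

Trunk **T-QLATTICE**, family `hubbard`, statement **hubbard.S23**. Proof file (theorems only)
behind the named facts `not_hasUniqueGappedGroundState_halfOddSpin` and
`no_unique_gapped_groundState_halfOddSpin` of `InfiniteVolume.lean` (Affleck–Lieb 1986;
Tasaki 2022, Cor. 3.6). With the local Hamiltonian of the spin-`n/2` Heisenberg chain in a region,
`H_{Λ'} = J Σ_{x, y = x+1 ∈ Λ'} 𝐒_x·𝐒_y` (`localHamiltonian_restrict_heisenbergInteraction`; the same formula is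
`localHamiltonian_heisenbergInteraction` of `InfiniteVolumeChainEnergyProofs.lean`), it proves the two chain-level identities of the
local-twist argument:

* `twist_conj_chainHamiltonian` — **the twisted chain** (Tasaki 2022, eqs. (3.10)–(3.12);
  Tasaki 2018, eqs. (3.4)–(3.6)): for the diagonal twist `U = U_θ` (`twistOp`),
  `Uᴴ H Uᴴ⁻¹… ` precisely `Uᴴ H U + U H Uᴴ - 2H = J Σ_{x, y=x+1} (cos(θ_y - θ_x) - 1)(S⁺_x S⁻_y + S⁻_x S⁺_y)`
  (bond by bond from the imported LSM bond identity, in ladder form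
  `twistOp_conj_spinDot_add_ladder`);
* `weightedMag_double_comm_chainHamiltonian` — **the block magnetisation**: for `M = Σ_z w_z Sᶻ_z`,
  `[M, [H, M]] = -J Σ_{x, y=x+1} ((w_x - w_y)²/2)(S⁺_x S⁻_y + S⁻_x S⁺_y)`; by the `U(1)` invariance of
  the bonds (`pairMagnetization_double_commutator`) only the bonds across which `w` changes
  contribute — for the indicator of a block, its two boundary bonds (the infinitesimal form of the
  variational estimate for the *uniform* block rotation `e^{iφM}`, Tasaki 2022 Lemma 3.1).

## References

* H. Tasaki, *The Lieb–Schultz–Mattis theorem: a topological point of view*, in: The Physics and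
  Mathematics of Elliott Lieb, vol. 2, EMS Press (2022) 405–446, arXiv:2202.06243 (held), §3.1,
  Lemma 3.1 and its proof, eqs. (3.9)–(3.13). [Tasaki2022]
* H. Tasaki, *Lieb–Schultz–Mattis theorem with a local twist …*, J. Stat. Phys. 170 (2018)
  653–671, arXiv:1708.05186 (held), §3, Lemma 1, eqs. (3.4)–(3.6). [Tasaki2018]
-/

noncomputable section

open Matrix Complex Finset
open scoped ComplexOrder Matrix.Norms.L2Operator

namespace Literature.MathematicalPhysics.QuantumLattice

open Literature.Probability.LatticeModels
open Literature.Probability.LatticeModels (Site)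

section ChainH

variable {d q : ℕ}

/-- Reindexing a sum over the sites of a subregion as a sum over the sites of the region. [folklore] -/
theorem sum_subregion_eq_sum_ite {M : Type*} [AddCommMonoid M] {Y Λ' : Finset (Site d)}
    (hY : Y ⊆ Λ') (G : ↥Λ' → M) :
    ∑ a : ↥Y, G ⟨a, hY a.2⟩ = ∑ x : ↥Λ', if (x : Site d) ∈ Y then G x else 0 := by
  rw [← Finset.sum_filter]
  refine Finset.sum_bij' (fun a _ => ⟨a, hY a.2⟩) (fun x hx => ⟨x, (Finset.mem_filter.1 hx).2⟩)
    ?_ ?_ ?_ ?_ ?_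
  · intro a _; exact Finset.mem_filter.2 ⟨mem_univ _, a.2⟩
  · intro x _; exact mem_univ _
  · intro a _; rfl
  · intro x _; rfl
  · intro a _; rfl

/-- Reindexing a double sum over the sites of a subregion. [folklore] -/
theorem sum_sum_subregion_eq {M : Type*} [AddCommMonoid M] {Y Λ' : Finset (Site d)}
    (hY : Y ⊆ Λ') (F : ↥Λ' → ↥Λ' → M) :
    ∑ a : ↥Y, ∑ b : ↥Y, F ⟨a, hY a.2⟩ ⟨b, hY b.2⟩ =
      ∑ x : ↥Λ', ∑ y : ↥Λ', if (x : Site d) ∈ Y ∧ (y : Site d) ∈ Y then F x y else 0 := by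
  refine (sum_subregion_eq_sum_ite hY (fun x => ∑ b : ↥Y, F x ⟨b, hY b.2⟩)).trans ?_
  refine Finset.sum_congr rfl fun x _ => ?_
  by_cases hx : (x : Site d) ∈ Y
  · rw [if_pos hx]
    refine (sum_subregion_eq_sum_ite hY (fun y => F x y)).trans ?_
    refine Finset.sum_congr rfl fun y _ => ?_
    simp only [hx, true_and]
  · rw [if_neg hx]
    symm
    refine Finset.sum_eq_zero fun y _ => ?_
    simp [hx]

/-- **The local Hamiltonian of the Heisenberg chain in a region**:
`H_{Λ'} = Σ_{X ⊆ Λ'} Φ X = J Σ_{x, y ∈ Λ', y = x + 1} 𝐒_x · 𝐒_y` for `Φ = heisenbergInteraction n J`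
(the only nonzero terms are `Φ {x, x+1} = J 𝐒_x·𝐒_{x+1}`). Tasaki (2022) §2.1, eq. (2.2) with
`ĥ_j = 𝐒_j·𝐒_{j+1}`; Bratteli–Robinson II §6.2.1, eq. (6.2.4). [cite: Tasaki2022, §2.1 eq. (2.2)] -/
theorem localHamiltonian_restrict_heisenbergInteraction (n : ℕ) (J : ℝ) (Λ' : Finset (Site 1)) :
    localHamiltonian ((heisenbergInteraction n J).restrict Λ') univ =
      (J : ℂ) • ∑ x : ↥Λ', ∑ y : ↥Λ',
        if (y : Site 1) = (x : Site 1) + 1 then spinDot n x y else 0 := by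
  rw [localHamiltonian_restrict_eq_sum]
  -- each term, embedded
  have hterm : ∀ Y ∈ Λ'.powerset,
      (if hY : Y ⊆ Λ' then embedOp hY (heisenbergInteraction n J Y) else 0) =
        (J : ℂ) • ∑ x : ↥Λ', ∑ y : ↥Λ',
          if Y.card = 2 ∧ (x : Site 1) ∈ Y ∧ (y : Site 1) ∈ Y ∧ (y : Site 1) = (x : Site 1) + 1
            then spinDot n x y else 0 := by
    intro Y hYp
    have hY : Y ⊆ Λ' := Finset.mem_powerset.1 hYp
    rw [dif_pos hY, heisenbergInteraction_apply]
    by_cases h2 : Y.card = 2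
    · rw [if_pos h2, embedOp_smul]
      congr 1
      simp only [embedOp_sum, apply_ite (embedOp hY), embedOp_zero, embedOp_spinDot]
      refine (sum_sum_subregion_eq hY (fun x y =>
        if (y : Site 1) = (x : Site 1) + 1 then spinDot n x y else 0)).trans ?_
      refine Finset.sum_congr rfl fun x _ => Finset.sum_congr rfl fun y _ => ?_
      simp only [h2, true_and]
      split_ifs <;> first | rfl | (exfalso; tauto)
    · rw [if_neg h2, embedOp_zero]
      symm
      rw [smul_eq_zero]
      right
      refine Finset.sum_eq_zero fun x _ => Finset.sum_eq_zero fun y _ => ?_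
      rw [if_neg]
      simp [h2]
  rw [Finset.sum_congr rfl hterm, ← Finset.smul_sum]
  congr 1
  rw [Finset.sum_comm]
  refine Finset.sum_congr rfl fun x _ => ?_
  rw [Finset.sum_comm]
  refine Finset.sum_congr rfl fun y _ => ?_
  -- the inner sum over `Y` has at most the single term `Y = {x, y}`
  by_cases hxy : (y : Site 1) = (x : Site 1) + 1
  · rw [if_pos hxy]
    have hne : (x : Site 1) ≠ (y : Site 1) := by
      intro e
      have := congrFun (e.trans hxy) 0
      simp at this
    rw [Finset.sum_eq_single_of_mem ({(x : Site 1), (y : Site 1)} : Finset (Site 1))]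
    · rw [if_pos ⟨Finset.card_pair hne, by simp, by simp, hxy⟩]
    · rw [Finset.mem_powerset]
      intro z hz
      rcases Finset.mem_insert.1 hz with rfl | hz
      · exact x.2
      · rw [Finset.mem_singleton.1 hz]; exact y.2
    · intro Y _ hYne
      rw [if_neg]
      rintro ⟨hc, hxY, hyY, -⟩
      apply hYne
      symm
      refine Finset.eq_of_subset_of_card_le (fun z hz => ?_) (by rw [Finset.card_pair hne, hc])
      rcases Finset.mem_insert.1 hz with rfl | hz
      · exact hxY
      · rw [Finset.mem_singleton.1 hz]; exact hyY
  · rw [if_neg hxy]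
    refine Finset.sum_eq_zero fun Y _ => ?_
    rw [if_neg]
    rintro ⟨-, -, -, h⟩
    exact hxy h

end ChainH

section ChainIdentities

variable (n : ℕ) (J : ℝ)

/-- Conjugating an `if … then A else 0`. [folklore] -/
theorem conj_ite {R : Type*} [Ring R] (U V A : R) (c : Prop) [Decidable c] :
    U * (if c then A else 0) * V = if c then U * A * V else 0 := by
  split_ifs <;> simp

/-- **Twisting the chain Hamiltonian** (Tasaki 2022, eqs. (3.10)–(3.12); Tasaki 2018, eqs. (3.4)–
(3.6)): for the diagonal twist `U = U_θ = exp[-i Σ_z θ_z (Ŝᶻ_z + S)]` (`twistOp`) on a region `Λ'`,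
`Uᴴ H_{Λ'} U + U H_{Λ'} Uᴴ - 2H_{Λ'} = J Σ_{x, y = x+1} (cos(θ_y - θ_x) - 1)(S⁺_x S⁻_y + S⁻_x S⁺_y)`
(bond by bond, `twistOp_conj_spinDot_add_ladder`). [cite: Tasaki2022, §3.1 eqs. (3.10)–(3.12)] -/
theorem twist_conj_chainHamiltonian (Λ' : Finset (Site 1)) (θ : ↥Λ' → ℝ) :
    (twistOp θ)ᴴ * localHamiltonian ((heisenbergInteraction n J).restrict Λ') univ * twistOp θ +
        twistOp θ * localHamiltonian ((heisenbergInteraction n J).restrict Λ') univ * (twistOp θ)ᴴ -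
      (2 : ℂ) • localHamiltonian ((heisenbergInteraction n J).restrict Λ') univ =
      (J : ℂ) • ∑ x : ↥Λ', ∑ y : ↥Λ',
        if (y : Site 1) = (x : Site 1) + 1 then
          ((Real.cos (θ y - θ x) - 1 : ℝ) : ℂ) •
            ((onSite x (spinRaise n) : Op ↥Λ' (n + 1)) * onSite y (spinLower n) +
              onSite x (spinLower n) * onSite y (spinRaise n))
        else 0 := by
  rw [localHamiltonian_restrict_heisenbergInteraction, mul_smul_comm, smul_mul_assoc, mul_smul_comm,
    smul_mul_assoc, smul_comm (2 : ℂ) (J : ℂ), ← smul_add, ← smul_sub]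
  congr 1
  simp only [Finset.mul_sum, Finset.sum_mul, Finset.smul_sum, ← Finset.sum_add_distrib,
    ← Finset.sum_sub_distrib]
  refine Finset.sum_congr rfl fun x _ => Finset.sum_congr rfl fun y _ => ?_
  rw [conj_ite, conj_ite, smul_ite, smul_zero]
  split_ifs with hxy
  · have hne : x ≠ y := by
      intro e
      have := congrFun (congrArg Subtype.val e) 0
      rw [hxy] at this
      simp at this
    exact twistOp_conj_spinDot_add_ladder n θ hne
  · simp

/-- Commuting an `if … then A else 0` with an operator. [folklore] -/
theorem ite_mul_sub_mul_ite {R : Type*} [Ring R] (A M : R) (c : Prop) [Decidable c] :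
    (if c then A else 0) * M - M * (if c then A else 0) = if c then A * M - M * A else 0 := by
  split_ifs <;> simp

/-- **The double commutator of the chain Hamiltonian with a weighted magnetisation**: for
`M = Σ_z w_z Sᶻ_z`, `[M, [H_{Λ'}, M]] = -J Σ_{x, y=x+1} ((w_x - w_y)²/2)(S⁺_x S⁻_y + S⁻_x S⁺_y)`; by the
`U(1)` invariance of the bonds only those across which `w` changes contribute (for the block
indicator `w`, the two boundary bonds: the mechanism of Tasaki 2018 Lemma 1 / Tasaki 2022
Lemma 3.1 for the *uniform* block rotation `e^{iφM}`, in infinitesimal form).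
[cite: Tasaki2022, §3.1 Lemma 3.1] -/
theorem weightedMag_double_comm_chainHamiltonian (Λ' : Finset (Site 1)) (w : Site 1 → ℂ)
    (M H : Op ↥Λ' (n + 1)) (hM : M = ∑ z : ↥Λ', w z • onSite z (SpinOperators.spinZ n))
    (hH : H = localHamiltonian ((heisenbergInteraction n J).restrict Λ') univ) :
    M * (H * M - M * H) - (H * M - M * H) * M =
      (J : ℂ) • ∑ x : ↥Λ', ∑ y : ↥Λ',
        if (y : Site 1) = (x : Site 1) + 1 then
          (-((w x - w y) ^ 2 / 2)) •
            ((onSite x (spinRaise n) : Op ↥Λ' (n + 1)) * onSite y (spinLower n) +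
              onSite x (spinLower n) * onSite y (spinRaise n))
        else 0 := by
  -- the inner commutator, bond by bond
  have hne : ∀ x y : ↥Λ', (y : Site 1) = (x : Site 1) + 1 → x ≠ y := by
    intro x y hxy e
    have := congrFun (congrArg Subtype.val e) 0
    rw [hxy] at this
    simp at this
  have hMxy : ∀ x y : ↥Λ', x ≠ y → ∀ z : ↥Λ', z ≠ x → z ≠ y →
      Commute (w x • onSite x (SpinOperators.spinZ n) + w y • onSite y (SpinOperators.spinZ n) :
        Op ↥Λ' (n + 1)) (onSite z (SpinOperators.spinZ n)) := by
    intro x y _ z hzx hzy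
    refine Commute.add_left (Commute.smul_left ?_ _) (Commute.smul_left ?_ _)
    · exact (onSite_mul_onSite_comm hzx.symm _ _)
    · exact (onSite_mul_onSite_comm hzy.symm _ _)
  have h1 : H * M - M * H = (J : ℂ) • ∑ x : ↥Λ', ∑ y : ↥Λ',
      if (y : Site 1) = (x : Site 1) + 1 then
        spinDot n x y * (w x • onSite x (SpinOperators.spinZ n) + w y • onSite y (SpinOperators.spinZ n)) -
          (w x • onSite x (SpinOperators.spinZ n) + w y • onSite y (SpinOperators.spinZ n)) *
            spinDot n x y
      else 0 := by
    rw [hH, localHamiltonian_restrict_heisenbergInteraction, smul_mul_assoc, mul_smul_comm, ← smul_sub]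
    congr 1
    simp only [Finset.sum_mul, Finset.mul_sum, ← Finset.sum_sub_distrib]
    refine Finset.sum_congr rfl fun x _ => Finset.sum_congr rfl fun y _ => ?_
    rw [ite_mul_sub_mul_ite]
    split_ifs with hxy
    · rw [hM]
      exact comm_weightedMag_eq_pair n (hne x y hxy) (fun z : ↥Λ' => w z) _
        (fun z hzx hzy => commute_spinDot_onSite_spinZ n hzx hzy)
    · rfl
  rw [h1, mul_smul_comm, smul_mul_assoc, ← smul_sub]
  congr 1
  simp only [Finset.sum_mul, Finset.mul_sum, ← Finset.sum_sub_distrib]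
  refine Finset.sum_congr rfl fun x _ => Finset.sum_congr rfl fun y _ => ?_
  rw [show ∀ (A : Op ↥Λ' (n + 1)) (c : Prop) [Decidable c],
      M * (if c then A else 0) - (if c then A else 0) * M = if c then M * A - A * M else 0 from
    fun A c _ => by split_ifs <;> simp]
  split_ifs with hxy
  · have hxy' := hne x y hxy
    set Mxy : Op ↥Λ' (n + 1) :=
      w x • onSite x (SpinOperators.spinZ n) + w y • onSite y (SpinOperators.spinZ n) with hMxy'
    set C := spinDot n x y * Mxy - Mxy * spinDot n x y with hC
    have hCz : ∀ z : ↥Λ', z ≠ x → z ≠ y → Commute C (onSite z (SpinOperators.spinZ n)) := by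
      intro z hzx hzy
      have h1 := commute_spinDot_onSite_spinZ n hzx hzy
      have h2 := hMxy x y hxy' z hzx hzy
      exact (h1.mul_left h2).sub_left (h2.mul_left h1)
    have : M * C - C * M = Mxy * C - C * Mxy := by
      have h := comm_weightedMag_eq_pair n hxy' (fun z : ↥Λ' => w z) C hCz
      rw [← hM] at h
      rw [← neg_sub, h, neg_sub]
    rw [this, hC]
    exact pairMagnetization_double_commutator n hxy' (w x) (w y) Mxy rfl
  · rfl

end ChainIdentities

end Literature.MathematicalPhysics.QuantumLattice
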